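import Literature.NumberTheory.Transcendental.NesterenkoGenericPointDerivatives
import Literature.NumberTheory.Transcendental.NesterenkoNormFormPolynomial
import Literature.RingTheory.MvPolynomial.IteratedDerivations
import Mathlib.RingTheory.Localization.AsSubring
import Mathlib.Algebra.MvPolynomial.Funext
import HarnessLib

/-!
# An order of the generic section field stable under the partial derivatives, and its specialisation

`Literature/NumberTheory/Transcendental/NesterenkoHilbertBoundOrder.lean` — the bookkeeping half of
Nesterenko's bound for the Hilbert function of a homogeneous prime ideal ([Nes3] Thm 1 = LNM 1752
Ch. 10 Lemma 3.1, absolute case), in the one-generic-point formulation of the tree. For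
`𝒢 : GSec m` (`𝔭 ⊂ ℚ[x̲]` prime of rank `s + 1`, chart `j`), `A = ℚ[U']`, `K' = ℚ(U')`,
`𝕃₀ = K'(ρ)`, `D = [𝕃₀ : K']`:

* `basisL0`, `crd i` — a `K'`-basis of `𝕃₀` and its coordinate functionals; `crd_mul` (structure
  constants) and **`crd_dL`**: `crd_i(∂̃_c y) = ∂_c(crd_i y) + ∑_{i'} crd_i(∂̃_c b_{i'}) · crd_{i'} y`;
* `denD ∈ A ∖ 0` — a common denominator of the coordinates of `ρ`, of the structure constants, of
  the `crd_i(∂̃_c b_{i'})` and of `crd_i 1`; `O0 = A[1/denD] ⊂ K'` (a localisation, `∂_c`-stable: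
  `dK_mem_O0`), `uspec` — a rational point with `denD(uspec) ≠ 0`, and the SPECIALISATION
  `tau : O0 →+* ℚ`, `u ↦ uspec` (`tau_algebraMap`); `dO0 c` — `∂_c` on `O0`, with
  `tau_iterD_algebraMap` (specialising an iterated derivative of a polynomial is evaluating its
  iterated partial derivative);
* `O ⊂ 𝕃₀` — the elements all of whose coordinates lie in `O0`: a subring containing `ρ` and `ℚ`,
  stable under the `∂̃_c` (`dL_mem_O`); `dLO c`, `crdO`, `rhoO`, `aevalO`, the matrices `TO`, `scO`,
  and the coordinate formulas `dO0_crdO`, `crdO_mul` inside `O0`; Lemma 1 inside `O`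
  (`dLO_aevalO`).

Nothing here is specific to Nesterenko beyond the choice of data; all statements are [folklore]
bookkeeping for `NesterenkoHilbertBound.lean`.

## References

* [Nes3] Yu. V. Nesterenko, Mat. Sb. 123 (1984), §2 (the ring `B[a⁻¹, Φ⁻¹]` and the
  specialisation `τ`).
* [NesterenkoPhilippon2001] LNM 1752, Ch. 10 Lemma 3.1 (p. 153).
-/

noncomputable section

set_option synthInstance.maxHeartbeats 400000

open MvPolynomial Module
open Literature.RingTheory.MvPolynomial

namespace Literature.NumberTheory.Transcendental

namespace Nesterenko

variable {m : ℕ}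

/-! ### Common denominators in a field of fractions -/

/-- **A finite family of fractions has a common denominator.** [folklore] -/
theorem exists_common_denominator {A K ι : Type*} [CommRing A] [IsDomain A] [Field K] [Algebra A K]
    [IsFractionRing A K] [Finite ι] (x : ι → K) :
    ∃ D : A, D ≠ 0 ∧ ∀ i, ∃ a : A, x i * algebraMap A K D = algebraMap A K a := by
  classical
  cases nonempty_fintype ι
  choose num den hden hx using fun i => IsFractionRing.div_surjective (A := A) (x i)
  refine ⟨∏ i, den i, Finset.prod_ne_zero_iff.mpr fun i _ => nonZeroDivisors.ne_zero (hden i),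
    fun i => ⟨num i * ∏ j ∈ Finset.univ.erase i, den j, ?_⟩⟩
  have hd : algebraMap A K (den i) ≠ 0 := IsFractionRing.to_map_ne_zero_of_mem_nonZeroDivisors (hden i)
  rw [← hx i, ← Finset.mul_prod_erase Finset.univ den (Finset.mem_univ i), map_mul, map_mul]
  field_simp

namespace GSec

variable (𝒢 : GSec m)

/-! ### A basis of `𝕃₀` over `K'` and coordinates -/

/-- `D = [𝕃₀ : K']` as the index bound of a basis. [folklore] -/
abbrev gdim : ℕ := finrank 𝒢.Kp 𝒢.L0

/-- `[𝕃₀ : K'] = deg 𝔭`. [cite: NesterenkoPhilippon2001, Ch. 3 Prop. 4.11 (pp. 40–41)] -/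
theorem gdim_eq_ideg : 𝒢.gdim = ideg 𝒢.𝔭 (𝒢.s + 1) := 𝒢.finrank_L0_eq_ideg

/-- `1 ≤ D`. [folklore] -/
theorem one_le_gdim : 1 ≤ 𝒢.gdim := by rw [gdim_eq_ideg]; exact 𝒢.one_le_ideg

/-- A `K'`-basis `b` of `𝕃₀`. [folklore] -/
def basisL0 : Basis (Fin 𝒢.gdim) 𝒢.Kp 𝒢.L0 := finBasis 𝒢.Kp 𝒢.L0

/-- The coordinate functionals of the basis. [folklore] -/
abbrev crd (i : Fin 𝒢.gdim) : 𝒢.L0 →ₗ[𝒢.Kp] 𝒢.Kp := 𝒢.basisL0.coord i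

/-- `y = ∑ crd_i(y) • b_i`. [folklore] -/
theorem sum_crd_smul (y : 𝒢.L0) : ∑ i, 𝒢.crd i y • 𝒢.basisL0 i = y :=
  𝒢.basisL0.sum_repr y

/-- Coordinates of basis vectors. [folklore] -/
theorem crd_basis (i i' : Fin 𝒢.gdim) : 𝒢.crd i (𝒢.basisL0 i') = if i' = i then 1 else 0 := by
  rw [Basis.coord_apply, Basis.repr_self, Finsupp.single_apply]

/-- **Structure constants**: `crd_i(yz) = ∑ crd_{i'}(y) crd_{i''}(z) crd_i(b_{i'} b_{i''})`. [folklore] -/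
theorem crd_mul (y z : 𝒢.L0) (i : Fin 𝒢.gdim) :
    𝒢.crd i (y * z) = ∑ i', ∑ i'', 𝒢.crd i' y * 𝒢.crd i'' z * 𝒢.crd i (𝒢.basisL0 i' * 𝒢.basisL0 i'') := by
  conv_lhs => rw [← 𝒢.sum_crd_smul y, ← 𝒢.sum_crd_smul z]
  rw [Finset.sum_mul, map_sum]
  refine Finset.sum_congr rfl fun i' _ => ?_
  rw [Finset.mul_sum, map_sum]
  refine Finset.sum_congr rfl fun i'' _ => ?_
  rw [smul_mul_smul_comm, map_smul, smul_eq_mul]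

set_option maxHeartbeats 400000 in
/-- **`∂̃_c` of a scalar multiple**: `∂̃_c(x • v) = ∂_c x • v + x • ∂̃_c v`. (The `algebraMap`s are
introduced through typed statements so that a single `Algebra K' 𝕃₀` instance is in play.)
[folklore] -/
theorem dL_smul (c : Fin 𝒢.s × Fin (m + 1)) (x : 𝒢.Kp) (v : 𝒢.L0) :
    𝒢.dL c (x • v) = 𝒢.dK c x • v + x • 𝒢.dL c v := by
  have h1 : x • v = algebraMap 𝒢.Kp 𝒢.L0 x * v := Algebra.smul_def x v
  have h2 : 𝒢.dL c (algebraMap 𝒢.Kp 𝒢.L0 x) = algebraMap 𝒢.Kp 𝒢.L0 (𝒢.dK c x) :=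
    𝒢.dL_algebraMap c x
  have h3 : 𝒢.dK c x • v = algebraMap 𝒢.Kp 𝒢.L0 (𝒢.dK c x) * v := Algebra.smul_def _ v
  have h4 : x • 𝒢.dL c v = algebraMap 𝒢.Kp 𝒢.L0 x * 𝒢.dL c v := Algebra.smul_def x _
  rw [h1, (𝒢.dL c).leibniz, h2, h3, h4, smul_eq_mul, smul_eq_mul]
  ring

/-- **Derivative of coordinates**:
`crd_i(∂̃_c y) = ∂_c(crd_i y) + ∑_{i'} crd_i(∂̃_c b_{i'}) · crd_{i'}(y)`. [folklore] -/
theorem crd_dL (c : Fin 𝒢.s × Fin (m + 1)) (y : 𝒢.L0) (i : Fin 𝒢.gdim) :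
    𝒢.crd i (𝒢.dL c y) =
      𝒢.dK c (𝒢.crd i y) + ∑ i', 𝒢.crd i (𝒢.dL c (𝒢.basisL0 i')) * 𝒢.crd i' y := by
  conv_lhs => rw [← 𝒢.sum_crd_smul y]
  rw [map_sum, map_sum]
  simp_rw [dL_smul, map_add, map_smul, smul_eq_mul, crd_basis]
  rw [Finset.sum_add_distrib]
  congr 1
  · simp
  · exact Finset.sum_congr rfl fun i' _ => mul_comm _ _

/-! ### The common denominator and the order `O0 = A[1/denD] ⊂ K'` -/

/-- The finitely many elements of `K'` we need to have a common denominator: the coordinates of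
`ρ`, the structure constants, the coordinates of the derivatives of the basis, and of `1`.
[folklore] -/
def denomFamily : (Fin 𝒢.gdim × Fin (m + 1)) ⊕ (Fin 𝒢.gdim × Fin 𝒢.gdim × Fin 𝒢.gdim) ⊕
    ((Fin 𝒢.s × Fin (m + 1)) × Fin 𝒢.gdim × Fin 𝒢.gdim) ⊕ Fin 𝒢.gdim → 𝒢.Kp
  | Sum.inl ⟨i, k⟩ => 𝒢.crd i (𝒢.rhoL0 k)
  | Sum.inr (Sum.inl ⟨i, i', i''⟩) => 𝒢.crd i (𝒢.basisL0 i' * 𝒢.basisL0 i'')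
  | Sum.inr (Sum.inr (Sum.inl ⟨c, i, i'⟩)) => 𝒢.crd i (𝒢.dL c (𝒢.basisL0 i'))
  | Sum.inr (Sum.inr (Sum.inr i)) => 𝒢.crd i 1

/-- Existence of the common denominator. [folklore] -/
theorem exists_denD : ∃ D : RU 𝒢.s m, D ≠ 0 ∧
    ∀ t, ∃ a : RU 𝒢.s m, 𝒢.denomFamily t * algebraMap (RU 𝒢.s m) 𝒢.Kp D =
      algebraMap (RU 𝒢.s m) 𝒢.Kp a :=
  exists_common_denominator 𝒢.denomFamily

/-- **The common denominator `denD ∈ A ∖ 0`.** [folklore] -/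
def denD : RU 𝒢.s m := 𝒢.exists_denD.choose

/-- `denD ≠ 0`. [folklore] -/
theorem denD_ne_zero : 𝒢.denD ≠ 0 := 𝒢.exists_denD.choose_spec.1

/-- `denD` clears the denominators of the family. [folklore] -/
theorem denD_spec (t) : ∃ a : RU 𝒢.s m, 𝒢.denomFamily t * algebraMap (RU 𝒢.s m) 𝒢.Kp 𝒢.denD =
    algebraMap (RU 𝒢.s m) 𝒢.Kp a :=
  𝒢.exists_denD.choose_spec.2 t

/-- `denD^n ≠ 0` in `K'`. [folklore] -/
theorem algebraMap_denD_pow_ne_zero (n : ℕ) :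
    algebraMap (RU 𝒢.s m) 𝒢.Kp (𝒢.denD ^ n) ≠ 0 :=
  (map_ne_zero_iff _ (IsFractionRing.injective _ _)).mpr (pow_ne_zero _ 𝒢.denD_ne_zero)

/-- **The order `O0 = A[1/denD] ⊂ K'`** (a localisation of `A` realised inside `K'`). [folklore] -/
def O0 : Subalgebra (RU 𝒢.s m) 𝒢.Kp :=
  Localization.subalgebra.ofField 𝒢.Kp (Submonoid.powers 𝒢.denD)
    (powers_le_nonZeroDivisors_of_noZeroDivisors 𝒢.denD_ne_zero)

/-- `O0` is the localisation of `A` at the powers of `denD`. [folklore] -/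
instance isLocalization_O0 : IsLocalization (Submonoid.powers 𝒢.denD) 𝒢.O0 :=
  Localization.subalgebra.isLocalization_ofField 𝒢.Kp _ _

/-- Membership in `O0`: `x · denD^n ∈ A` for some `n`. [folklore] -/
theorem mem_O0_iff (x : 𝒢.Kp) : x ∈ 𝒢.O0 ↔ ∃ (a : RU 𝒢.s m) (n : ℕ),
    x * algebraMap (RU 𝒢.s m) 𝒢.Kp (𝒢.denD ^ n) = algebraMap (RU 𝒢.s m) 𝒢.Kp a := by
  change (∃ (a s : RU 𝒢.s m) (_ : s ∈ Submonoid.powers 𝒢.denD),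
    x = algebraMap (RU 𝒢.s m) 𝒢.Kp a * (algebraMap (RU 𝒢.s m) 𝒢.Kp s)⁻¹) ↔ _
  constructor
  · rintro ⟨a, s, hs, rfl⟩
    obtain ⟨n, rfl⟩ := (Submonoid.mem_powers_iff _ _).mp hs
    exact ⟨a, n, by rw [mul_assoc, inv_mul_cancel₀ (𝒢.algebraMap_denD_pow_ne_zero n), mul_one]⟩
  · rintro ⟨a, n, h⟩
    refine ⟨a, 𝒢.denD ^ n, (Submonoid.mem_powers_iff _ _).mpr ⟨n, rfl⟩, ?_⟩
    rw [← h, mul_assoc, mul_inv_cancel₀ (𝒢.algebraMap_denD_pow_ne_zero n), mul_one]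

/-- Polynomials lie in `O0`. [folklore] -/
theorem algebraMap_mem_O0 (a : RU 𝒢.s m) : algebraMap (RU 𝒢.s m) 𝒢.Kp a ∈ 𝒢.O0 :=
  𝒢.O0.algebraMap_mem a

/-- Rational constants lie in `O0`. [folklore] -/
theorem ratCast_mem_O0 (q : ℚ) : (q : 𝒢.Kp) ∈ 𝒢.O0 := by
  rw [← eq_ratCast ((algebraMap (RU 𝒢.s m) 𝒢.Kp).comp (algebraMap ℚ (RU 𝒢.s m))) q]
  exact 𝒢.algebraMap_mem_O0 _

/-- The members of the family lie in `O0`. [folklore] -/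
theorem denomFamily_mem (t) : 𝒢.denomFamily t ∈ 𝒢.O0 := by
  obtain ⟨a, ha⟩ := 𝒢.denD_spec t
  exact (𝒢.mem_O0_iff _).mpr ⟨a, 1, by rw [pow_one]; exact ha⟩

/-- **`O0` is stable under the partial derivatives `∂_c`.** (`x denD^n = a` gives
`∂x · denD^{2n} = ∂a · denD^n − a · ∂(denD^n)`.) [folklore] -/
theorem dK_mem_O0 (c : Fin 𝒢.s × Fin (m + 1)) {x : 𝒢.Kp} (hx : x ∈ 𝒢.O0) : 𝒢.dK c x ∈ 𝒢.O0 := by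
  obtain ⟨a, n, h⟩ := (𝒢.mem_O0_iff x).mp hx
  refine (𝒢.mem_O0_iff _).mpr ⟨pderiv c a * 𝒢.denD ^ n - a * pderiv c (𝒢.denD ^ n), 2 * n, ?_⟩
  have h1 := congrArg (𝒢.dK c) h
  rw [(𝒢.dK c).leibniz, dK_algebraMap, dK_algebraMap] at h1
  simp only [smul_eq_mul] at h1
  -- h1 : x * ∂(D^n) + D^n * ∂x = ∂a  (as images)
  rw [two_mul, pow_add, map_mul (algebraMap (RU 𝒢.s m) 𝒢.Kp) (𝒢.denD ^ n), map_sub, map_mul, map_mul,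
    ← h]
  have e1 : algebraMap (RU 𝒢.s m) 𝒢.Kp (pderiv c a) =
      x * algebraMap (RU 𝒢.s m) 𝒢.Kp (pderiv c (𝒢.denD ^ n)) +
        algebraMap (RU 𝒢.s m) 𝒢.Kp (𝒢.denD ^ n) * 𝒢.dK c x := h1.symm
  rw [e1]
  ring

/-! ### The specialisation `tau : O0 → ℚ` -/

/-- A rational point where `denD` does not vanish (`ℚ` is infinite). [folklore] -/
theorem exists_eval_denD_ne_zero : ∃ u : Fin 𝒢.s × Fin (m + 1) → ℚ, eval u 𝒢.denD ≠ 0 := by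
  by_contra h
  push Not at h
  exact 𝒢.denD_ne_zero (MvPolynomial.funext fun u => by rw [h u, map_zero])

/-- **The specialisation point `uspec`.** [folklore] -/
def uspec : Fin 𝒢.s × Fin (m + 1) → ℚ := 𝒢.exists_eval_denD_ne_zero.choose

/-- `denD(uspec) ≠ 0`. [folklore] -/
theorem eval_uspec_denD_ne_zero : eval 𝒢.uspec 𝒢.denD ≠ 0 :=
  𝒢.exists_eval_denD_ne_zero.choose_spec

/-- Powers of `denD` specialise to units. [folklore] -/
theorem isUnit_eval_powers (y : Submonoid.powers 𝒢.denD) :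
    IsUnit ((eval 𝒢.uspec : RU 𝒢.s m →+* ℚ) y) := by
  obtain ⟨n, hn⟩ := (Submonoid.mem_powers_iff _ _).mp y.2
  rw [← hn, map_pow]
  exact (isUnit_iff_ne_zero.mpr 𝒢.eval_uspec_denD_ne_zero).pow n

/-- **The specialisation `tau : O0 → ℚ`, `u ↦ uspec`** (the universal property of the
localisation). [cite: NesterenkoPhilippon2001, Ch. 10 Lemma 3.1, via [Nes3] §2 (the homomorphism `τ`)] -/
def tau : 𝒢.O0 →+* ℚ :=
  IsLocalization.lift (M := Submonoid.powers 𝒢.denD) 𝒢.isUnit_eval_powers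

/-- `tau` on polynomials is evaluation at `uspec`. [folklore] -/
@[simp] theorem tau_algebraMap (a : RU 𝒢.s m) :
    𝒢.tau (algebraMap (RU 𝒢.s m) 𝒢.O0 a) = eval 𝒢.uspec a :=
  IsLocalization.lift_eq _ a

/-- The coercion of `algebraMap A O0`. [folklore] -/
theorem coe_algebraMap_O0 (a : RU 𝒢.s m) :
    ((algebraMap (RU 𝒢.s m) 𝒢.O0 a : 𝒢.O0) : 𝒢.Kp) = algebraMap (RU 𝒢.s m) 𝒢.Kp a := rfl

/-! ### `∂_c` on `O0` -/

/-- **`∂_c` restricted to `O0`.** [folklore] -/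
def dO0 (c : Fin 𝒢.s × Fin (m + 1)) : Derivation ℤ 𝒢.O0 𝒢.O0 where
  toLinearMap :=
    { toFun := fun x => ⟨𝒢.dK c x, 𝒢.dK_mem_O0 c x.2⟩
      map_add' := fun x y => Subtype.ext (by simp)
      map_smul' := fun n x => Subtype.ext (by simp) }
  map_one_eq_zero' := Subtype.ext (by simp)
  leibniz' x y := Subtype.ext (by
    simp only [LinearMap.coe_mk, AddHom.coe_mk, Subalgebra.coe_mul, Derivation.leibniz, smul_eq_mul,
      Subalgebra.coe_add])

/-- `dO0` is `dK` on the underlying element. [folklore] -/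
@[simp] theorem coe_dO0 (c : Fin 𝒢.s × Fin (m + 1)) (x : 𝒢.O0) : ((𝒢.dO0 c x : 𝒢.O0) : 𝒢.Kp) = 𝒢.dK c x :=
  rfl

/-- `dO0` of a polynomial. [folklore] -/
theorem dO0_algebraMap (c : Fin 𝒢.s × Fin (m + 1)) (a : RU 𝒢.s m) :
    𝒢.dO0 c (algebraMap (RU 𝒢.s m) 𝒢.O0 a) = algebraMap (RU 𝒢.s m) 𝒢.O0 (pderiv c a) :=
  Subtype.ext (by rw [coe_dO0, coe_algebraMap_O0, dK_algebraMap]; rfl)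

/-- **Specialising an iterated derivative of a polynomial is evaluating its iterated partial
derivative at `uspec`.** [folklore] -/
theorem tau_iterD_algebraMap (w : List (Fin 𝒢.s × Fin (m + 1))) (a : RU 𝒢.s m) :
    𝒢.tau (iterD (dmap 𝒢.dO0) w (algebraMap (RU 𝒢.s m) 𝒢.O0 a)) =
      eval 𝒢.uspec (iterD (dmap fun c : Fin 𝒢.s × Fin (m + 1) => pderiv (R := ℚ) c) w a) := by
  have key : ∀ w : List (Fin 𝒢.s × Fin (m + 1)), iterD (dmap 𝒢.dO0) w (algebraMap (RU 𝒢.s m) 𝒢.O0 a) =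
      algebraMap (RU 𝒢.s m) 𝒢.O0 (iterD (dmap fun c : Fin 𝒢.s × Fin (m + 1) => pderiv (R := ℚ) c) w a) := by
    intro w
    induction w with
    | nil => rfl
    | cons c w ih => rw [iterD_cons, iterD_cons, ih, dmap, dmap, dO0_algebraMap]
  rw [key, tau_algebraMap]

/-! ### The order `O ⊂ 𝕃₀` -/

/-- **`O ⊂ 𝕃₀`: the elements all of whose coordinates lie in `O0`.** [folklore] -/
def O : Subring 𝒢.L0 where
  carrier := {y | ∀ i, 𝒢.crd i y ∈ 𝒢.O0}
  mul_mem' {y z} hy hz i := by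
    rw [crd_mul]
    refine 𝒢.O0.sum_mem fun i' _ => 𝒢.O0.sum_mem fun i'' _ => ?_
    exact 𝒢.O0.mul_mem (𝒢.O0.mul_mem (hy i') (hz i'')) (𝒢.denomFamily_mem (Sum.inr (Sum.inl ⟨i, i', i''⟩)))
  one_mem' i := 𝒢.denomFamily_mem (Sum.inr (Sum.inr (Sum.inr i)))
  add_mem' {y z} hy hz i := by rw [map_add]; exact 𝒢.O0.add_mem (hy i) (hz i)
  zero_mem' i := by rw [map_zero]; exact 𝒢.O0.zero_mem
  neg_mem' {y} hy i := by rw [map_neg]; exact 𝒢.O0.neg_mem (hy i)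

/-- Membership in `O`. [folklore] -/
theorem mem_O_iff (y : 𝒢.L0) : y ∈ 𝒢.O ↔ ∀ i, 𝒢.crd i y ∈ 𝒢.O0 := Iff.rfl

/-- `ρₖ ∈ O`. [folklore] -/
theorem rhoL0_mem_O (k : Fin (m + 1)) : 𝒢.rhoL0 k ∈ 𝒢.O := fun i =>
  𝒢.denomFamily_mem (Sum.inl ⟨i, k⟩)

/-- Scalars from `O0` act on `O`. [folklore] -/
theorem smul_mem_O {x : 𝒢.Kp} (hx : x ∈ 𝒢.O0) {y : 𝒢.L0} (hy : y ∈ 𝒢.O) : x • y ∈ 𝒢.O := fun i => by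
  rw [map_smul, smul_eq_mul]; exact 𝒢.O0.mul_mem hx (hy i)

/-- Elements of `O0` (as scalars) lie in `O`. [folklore] -/
theorem algebraMap_mem_O {x : 𝒢.Kp} (hx : x ∈ 𝒢.O0) : algebraMap 𝒢.Kp 𝒢.L0 x ∈ 𝒢.O := by
  rw [Algebra.algebraMap_eq_smul_one]
  exact 𝒢.smul_mem_O hx 𝒢.O.one_mem

/-- Rational constants lie in `O`. [folklore] -/
theorem ratCast_mem_O (q : ℚ) : algebraMap 𝒢.Kp 𝒢.L0 (q : 𝒢.Kp) ∈ 𝒢.O :=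
  𝒢.algebraMap_mem_O (𝒢.ratCast_mem_O0 q)

/-- `R(ρ)` on a constant. [folklore] -/
theorem aeval_rhoL0_C (q : ℚ) : (aeval 𝒢.rhoL0 (C q) : 𝒢.L0) = algebraMap 𝒢.Kp 𝒢.L0 (q : 𝒢.Kp) := by
  rw [aeval_C, eq_ratCast, map_ratCast]

/-- **`R(ρ) ∈ O`** for every rational polynomial `R`. [folklore] -/
theorem aeval_rhoL0_mem_O (R : Rx m) : aeval 𝒢.rhoL0 R ∈ 𝒢.O := by
  induction R using MvPolynomial.induction_on with
  | C q => rw [aeval_rhoL0_C]; exact 𝒢.ratCast_mem_O q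
  | add P Q hP hQ => rw [map_add]; exact 𝒢.O.add_mem hP hQ
  | mul_X P k hP => rw [map_mul, aeval_X]; exact 𝒢.O.mul_mem hP (𝒢.rhoL0_mem_O k)

/-- **`O` is stable under the `∂̃_c`.** [folklore] -/
theorem dL_mem_O (c : Fin 𝒢.s × Fin (m + 1)) {y : 𝒢.L0} (hy : y ∈ 𝒢.O) : 𝒢.dL c y ∈ 𝒢.O := fun i => by
  rw [crd_dL]
  refine 𝒢.O0.add_mem (𝒢.dK_mem_O0 c (hy i)) (𝒢.O0.sum_mem fun i' _ => ?_)
  exact 𝒢.O0.mul_mem (𝒢.denomFamily_mem (Sum.inr (Sum.inr (Sum.inl ⟨c, i, i'⟩)))) (hy i')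

/-- **`∂̃_c` restricted to `O`.** [folklore] -/
def dLO (c : Fin 𝒢.s × Fin (m + 1)) : Derivation ℤ 𝒢.O 𝒢.O where
  toLinearMap :=
    { toFun := fun y => ⟨𝒢.dL c y, 𝒢.dL_mem_O c y.2⟩
      map_add' := fun x y => Subtype.ext (by simp)
      map_smul' := fun n x => Subtype.ext (by simp) }
  map_one_eq_zero' := Subtype.ext (by simp)
  leibniz' x y := Subtype.ext (by
    simp only [LinearMap.coe_mk, AddHom.coe_mk, Subring.coe_mul, Derivation.leibniz, smul_eq_mul,
      Subring.coe_add])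

/-- `dLO` is `dL` on the underlying element. [folklore] -/
@[simp] theorem coe_dLO (c : Fin 𝒢.s × Fin (m + 1)) (y : 𝒢.O) : ((𝒢.dLO c y : 𝒢.O) : 𝒢.L0) = 𝒢.dL c y :=
  rfl

/-- The `dLO` commute. [folklore] -/
theorem dLO_comm (c c' : Fin 𝒢.s × Fin (m + 1)) (y : 𝒢.O) :
    𝒢.dLO c (𝒢.dLO c' y) = 𝒢.dLO c' (𝒢.dLO c y) :=
  Subtype.ext (𝒢.dL_comm c c' y)

/-- Iterating `dLO` is iterating `dL` on the underlying element. [folklore] -/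
theorem coe_iterD_dLO (w : List (Fin 𝒢.s × Fin (m + 1))) (y : 𝒢.O) :
    ((iterD (dmap 𝒢.dLO) w y : 𝒢.O) : 𝒢.L0) = iterD (fun c => ⇑(𝒢.dL c)) w (y : 𝒢.L0) := by
  induction w with
  | nil => rfl
  | cons c w ih => rw [iterD_cons, iterD_cons, dmap, coe_dLO, ih]

/-- `ρ_q` as an element of `O`. [folklore] -/
def rhoO (q : Fin (m + 1)) : 𝒢.O := ⟨𝒢.rhoL0 q, 𝒢.rhoL0_mem_O q⟩

/-- `R(ρ)` as an element of `O`. [folklore] -/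
def aevalO (R : Rx m) : 𝒢.O := ⟨aeval 𝒢.rhoL0 R, 𝒢.aeval_rhoL0_mem_O R⟩

/-- `aevalO` is additive. [folklore] -/
theorem aevalO_add (R R' : Rx m) : 𝒢.aevalO (R + R') = 𝒢.aevalO R + 𝒢.aevalO R' :=
  Subtype.ext (by simp [aevalO])

/-- A rational constant as an element of `O`. [folklore] -/
def ratO (q : ℚ) : 𝒢.O := ⟨algebraMap 𝒢.Kp 𝒢.L0 (q : 𝒢.Kp), 𝒢.ratCast_mem_O q⟩

/-- `aevalO` and rational scalars: `aevalO (C q * R) = ratO q * aevalO R`. [folklore] -/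
theorem aevalO_C_mul (q : ℚ) (R : Rx m) : 𝒢.aevalO (C q * R) = 𝒢.ratO q * 𝒢.aevalO R := by
  refine Subtype.ext ?_
  change aeval 𝒢.rhoL0 (C q * R) = algebraMap 𝒢.Kp 𝒢.L0 (q : 𝒢.Kp) * aeval 𝒢.rhoL0 R
  rw [map_mul, aeval_rhoL0_C]

/-- **Lemma 1 inside `O`**: `∂̃_{pq} R(ρ) = ρ_q ∂̃_{pj} R(ρ)` for `q ≠ j`.
[cite: NesterenkoPhilippon2001, Ch. 10 Lemma 3.1 (p. 153), via [Nes3] Lemma 1] -/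
theorem dLO_aevalO (p : Fin 𝒢.s) {q : Fin (m + 1)} (hq : q ≠ 𝒢.j) (R : Rx m) :
    𝒢.dLO (p, q) (𝒢.aevalO R) = 𝒢.rhoO q * 𝒢.dLO (p, 𝒢.j) (𝒢.aevalO R) :=
  Subtype.ext (𝒢.dL_aeval_rhoL0 p hq R)

/-! ### Coordinates inside `O0` -/

/-- The `i`-th coordinate of an element of `O`, as an element of `O0`. [folklore] -/
def crdO (i : Fin 𝒢.gdim) (y : 𝒢.O) : 𝒢.O0 := ⟨𝒢.crd i y, y.2 i⟩

/-- `crdO` unfolded. [folklore] -/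
@[simp] theorem coe_crdO (i : Fin 𝒢.gdim) (y : 𝒢.O) : ((𝒢.crdO i y : 𝒢.O0) : 𝒢.Kp) = 𝒢.crd i y := rfl

/-- `crdO` is additive. [folklore] -/
theorem crdO_add (i : Fin 𝒢.gdim) (y z : 𝒢.O) : 𝒢.crdO i (y + z) = 𝒢.crdO i y + 𝒢.crdO i z :=
  Subtype.ext (by simp)

/-- `crdO` of zero. [folklore] -/
theorem crdO_zero (i : Fin 𝒢.gdim) : 𝒢.crdO i 0 = 0 := Subtype.ext (by simp)

/-- The matrix `T_c = (crd_i(∂̃_c b_{i'}))` inside `O0`. [folklore] -/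
def TO (c : Fin 𝒢.s × Fin (m + 1)) (i i' : Fin 𝒢.gdim) : 𝒢.O0 :=
  ⟨𝒢.crd i (𝒢.dL c (𝒢.basisL0 i')), 𝒢.denomFamily_mem (Sum.inr (Sum.inr (Sum.inl ⟨c, i, i'⟩)))⟩

/-- The structure constants inside `O0`. [folklore] -/
def scO (i i' i'' : Fin 𝒢.gdim) : 𝒢.O0 :=
  ⟨𝒢.crd i (𝒢.basisL0 i' * 𝒢.basisL0 i''), 𝒢.denomFamily_mem (Sum.inr (Sum.inl ⟨i, i', i''⟩))⟩

/-- `TO` unfolded. [folklore] -/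
@[simp] theorem coe_TO (c : Fin 𝒢.s × Fin (m + 1)) (i i' : Fin 𝒢.gdim) :
    ((𝒢.TO c i i' : 𝒢.O0) : 𝒢.Kp) = 𝒢.crd i (𝒢.dL c (𝒢.basisL0 i')) := rfl

/-- `scO` unfolded. [folklore] -/
@[simp] theorem coe_scO (i i' i'' : Fin 𝒢.gdim) :
    ((𝒢.scO i i' i'' : 𝒢.O0) : 𝒢.Kp) = 𝒢.crd i (𝒢.basisL0 i' * 𝒢.basisL0 i'') := rfl

/-- **Derivative of coordinates inside `O0`**:
`∂_c(crd_i y) = crd_i(∂̃_c y) − ∑_{i'} T_c(i, i') crd_{i'}(y)`. [folklore] -/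
theorem dO0_crdO (c : Fin 𝒢.s × Fin (m + 1)) (i : Fin 𝒢.gdim) (y : 𝒢.O) :
    𝒢.dO0 c (𝒢.crdO i y) = 𝒢.crdO i (𝒢.dLO c y) - ∑ i', 𝒢.TO c i i' * 𝒢.crdO i' y := by
  refine Subtype.ext ?_
  simp only [coe_dO0, coe_crdO, AddSubgroupClass.coe_sub, AddSubmonoidClass.coe_finsetSum,
    MulMemClass.coe_mul, coe_dLO, coe_TO]
  rw [crd_dL]
  ring

/-- **Coordinates of a product inside `O0`.** [folklore] -/
theorem crdO_mul (i : Fin 𝒢.gdim) (y z : 𝒢.O) :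
    𝒢.crdO i (y * z) = ∑ i', ∑ i'', 𝒢.crdO i' y * 𝒢.crdO i'' z * 𝒢.scO i i' i'' := by
  refine Subtype.ext ?_
  simp only [coe_crdO, MulMemClass.coe_mul, AddSubmonoidClass.coe_finsetSum, coe_scO]
  rw [crd_mul]

/-- Coordinates of a scalar multiple from `O0`. [folklore] -/
theorem crdO_smul (i : Fin 𝒢.gdim) (x : 𝒢.O0) (y : 𝒢.O) :
    𝒢.crdO i ⟨(x : 𝒢.Kp) • (y : 𝒢.L0), 𝒢.smul_mem_O x.2 y.2⟩ = x * 𝒢.crdO i y :=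
  Subtype.ext (by simp [crdO])

end GSec

end Nesterenko

end Literature.NumberTheory.Transcendental
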